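import Summits.BirchSwinnertonDyer.BirchSwinnertonDyer.Theorems.AlignedTransportAtTwoMainConjectureOfRankZeroBSDAtTwoFineRoadTowerImage
import Literature.NumberTheory.EllipticCurves.TwoAdicImageSurjectivityModTwoProofs
import Literature.NumberTheory.EllipticCurves.ZpExtensionLayersProofs
import HarnessLib

/-!
# `Gal(K̄/K_∞)` contains a TRANSPOSITION on `E[2]` iff `√Δ_E ∉ K_∞` — the `C₃ / S₃` dichotomy of the counting lemma for road (b″)
# is decided by one element `δ = ∏_{i<j}(xᵢ − xⱼ)` (`16 δ² = Δ_E`) of the tower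

Cell `bsd-f1-sign2`, WIDTH-5 attach seat `bsd-line-att-p5` (gen 7) on line `birth` of crux C2 stmt-BirchSwinnertonDyer-22298
`MainConjectureOfRankZeroBSDAtTwo` (route `AlignedTransportAtTwo`); sequel of `…FineRoadTowerImage` (att-p5 g7). A
`--supports 22298 --as helper` file. HONEST FRAMING: THEOREMS ONLY — no definition, no named fact, no `sorry`; C2-NEUTRAL; BSD is NOT
proved by any of this.

WHAT. `K` any field with `2 ≠ 0`, `E/K` elliptic, `T₀, T₁, T₂` the non-zero `2`-torsion points, `xᵢ = x(Tᵢ)`,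
`δ := (x₀ − x₁)(x₀ − x₂)(x₁ − x₂) ∈ K̄` (tree `DokchitserDokchitser2012.delta`, `algebraMap_Δ : Δ = 16 δ²`, `smul_delta : σδ = sign(σ)δ`):

* §1 `isTransposition_iff_sign_permGal_eq_neg_one`, **`isTransposition_iff_smul_delta_ne`**: `σ ∈ Γ_K` fixes a non-zero `2`-torsion
  point and moves another (acts as a TRANSPOSITION) iff `σ` is odd on `{T₀, T₁, T₂}` iff `σ δ ≠ δ` (then `σ δ = −δ`);
  `trivial_or_fpf_iff_smul_delta_eq`: `σ` acts trivially or without non-zero fixed point (`σ̄ ∈ A₃`) iff `σ δ = δ`.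
* §2 for a subgroup `H ≤ Γ_K`: `H` contains a transposition iff `H` does not fix `δ`; `H` has NO transposition (the hypothesis `hnoT`
  of `PerfectDescent.natCard_equivariant_eq_of_no_transposition`) iff `H` fixes `δ`.
* §3 `H = ker κ = Gal(K̄/K_∞)` for a `ℤ_p`-extension `κ`: `mem_top_iff_forall_smul_eq` (`x ∈ K_∞ ⟺ ker κ` fixes `x`), hence
  **`exists_transposition_mem_kerSubgroup_iff_delta_not_mem_top`**: `Gal(K̄/K_∞)` contains a transposition on `E[2]` iff `δ ∉ K_∞`
  («`√Δ_E ∉ K_∞`»), and `forall_trivial_or_fpf_iff_delta_mem_top`.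
* §4 `K = ℚ`: `delta_not_mem_top_of_Δ_neg` (`Δ < 0`, cyclotomic `κ`: `δ ∉ ℚ_∞` — complex conjugation moves it); on the seed cell of crux
  C2 (`p = 2`, cyclotomic, no rational point of order `2`) **`S3_or_C3_kerSubgroup`**: EITHER `δ ∉ ℚ_∞` and `Gal(ℚ̄/ℚ_∞)` supplies the
  `S₃` data `(σ, τ, m₀)` of `PerfectDescent.natCard_equivariant_S3_bounds`, OR `δ ∈ ℚ_∞` and it supplies the `C₃` data (a fixed-point-free
  `σ`, and every element trivial-or-fixed-point-free) of `PerfectDescent.natCard_equivariant_eq_of_no_transposition` — the dichotomy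
  `G_∞ ∈ {S₃, C₃}` of PERFECT-DESCENT.md §3 (iii) is «`√Δ_E ∉ ℚ_∞` / `√Δ_E ∈ ℚ_∞`», and the first case contains the whole `Δ < 0` half-cell.
  (Which `Δ > 0` curves have `√Δ ∈ ℚ_∞` — `Δ ∈ 2·ℚ^{×2}`, the quadratic subfield of `ℚ_∞` being `ℚ(√2)` — is not treated here.)

References: T. Dokchitser, V. Dokchitser, Math. Z. 272 (2012) 961–964 (proof of Thm.: `ℚ(E[2]) ⊇ ℚ(√Δ)`); J.-P. Serre, Invent. Math. 15
(1972) §5.3; L. Washington, *Introduction to Cyclotomic Fields* §13.1; the crux workfile `PERFECT-DESCENT.md` §3 (iii).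
-/

set_option autoImplicit false
-- the Theorems namespace of this sub repeats the summit name by design (D-0017 nested layout)
set_option linter.dupNamespace false

namespace Summit.BirchSwinnertonDyer.BirchSwinnertonDyer.Theorems.AlignedTransportAtTwoFineRoad.TowerImageDelta

/-- A permutation of three letters with a fixed letter and a moved letter is odd. [folklore] -/
private theorem perm_three_sign_of_fixed_of_moved :
    ∀ g : Equiv.Perm (Fin 3), ∀ i j : Fin 3, g i = i → g j ≠ j → Equiv.Perm.sign g = -1 := by
  decide

/-- An odd permutation of three letters fixes some letter and moves some letter. [folklore] -/
private theorem perm_three_fixed_and_moved_of_sign :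
    ∀ g : Equiv.Perm (Fin 3), Equiv.Perm.sign g = -1 → (∃ i : Fin 3, g i = i) ∧ ∃ j : Fin 3, g j ≠ j := by
  decide

end Summit.BirchSwinnertonDyer.BirchSwinnertonDyer.Theorems.AlignedTransportAtTwoFineRoad.TowerImageDelta

noncomputable section

open scoped Classical

namespace Summit.BirchSwinnertonDyer.BirchSwinnertonDyer.Theorems.AlignedTransportAtTwoFineRoad.TowerImageDelta

open WeierstrassCurve Field Literature.NumberTheory.EllipticCurves Literature.NumberTheory.GaloisRepresentations
  Literature.NumberTheory.EllipticCurves.Rank1Residual Literature.NumberTheory.EllipticCurves.Greenberg1999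
  Literature.NumberTheory.EllipticCurves.DokchitserDokchitser2012
  Summit.BirchSwinnertonDyer.BirchSwinnertonDyer.Theorems.AlignedTransportAtTwoFineRoad
  Summit.BirchSwinnertonDyer.BirchSwinnertonDyer.Theorems.AlignedTransportAtTwoFineRoad.TowerImage

universe u

/-! ## §1 One element: transposition ⟺ odd ⟺ moves `δ` -/

section One

variable {K : Type u} [Field K] (W : WeierstrassCurve K) [W.IsElliptic] (h2 : (2 : K) ≠ 0)

/-- **`σ` acts on `E[2]` as a transposition iff `σ` is ODD on `{T₀, T₁, T₂}`**: "fixes a non-zero point and moves another" read on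
the letters `Tᵢ` (`eq_zero_or_eq_T`, `T_permGal`). [cite: SilvermanAEC2009, III.§7] [cite: Serre1972, §5.3] -/
theorem isTransposition_iff_sign_permGal_eq_neg_one (σ : absoluteGaloisGroup K) :
    (∃ m₀ v : W.geomTorsion 2, m₀ ≠ 0 ∧ σ • m₀ = m₀ ∧ σ • v ≠ v) ↔ Equiv.Perm.sign (permGal W h2 σ) = -1 := by
  constructor
  · rintro ⟨m₀, v, hm₀, hσm₀, hσv⟩
    obtain ⟨i, rfl⟩ : ∃ i, m₀ = T W h2 i := (eq_zero_or_eq_T W h2 m₀).resolve_left hm₀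
    have hv0 : v ≠ 0 := fun h ↦ hσv (by rw [h, smul_zero])
    obtain ⟨j, rfl⟩ : ∃ j, v = T W h2 j := (eq_zero_or_eq_T W h2 v).resolve_left hv0
    have hi : permGal W h2 σ i = i := T_injective W h2 (by rw [T_permGal, hσm₀])
    have hj : permGal W h2 σ j ≠ j := fun h ↦ hσv (by rw [← T_permGal, h])
    exact perm_three_sign_of_fixed_of_moved _ i j hi hj
  · intro hs
    obtain ⟨⟨i, hi⟩, j, hj⟩ := perm_three_fixed_and_moved_of_sign _ hs
    refine ⟨T W h2 i, T W h2 j, fun h ↦ coe_T_ne_zero W h2 i (by rw [h]; rfl), by rw [← T_permGal, hi], fun h ↦ hj ?_⟩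
    exact T_injective W h2 (by rw [T_permGal, h])

/-- `σ` is odd on `{T₀, T₁, T₂}` iff `σ δ ≠ δ` (`σ δ = sign(σ) δ`, `δ ≠ 0`, `2 ≠ 0`).
[cite: DokchitserDokchitserMathZ2012, Theorem (1), proof (ℚ(E[2]) ⊃ ℚ(√Δ))] -/
theorem sign_permGal_eq_neg_one_iff_smul_delta_ne (σ : absoluteGaloisGroup K) :
    Equiv.Perm.sign (permGal W h2 σ) = -1 ↔ σ • delta W h2 ≠ delta W h2 := by
  rw [smul_delta]
  have hδ := delta_ne_zero W h2
  have h2' : (2 : AlgebraicClosure K) ≠ 0 := fun h0 ↦ h2 ((algebraMap K (AlgebraicClosure K)).injective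
    (by rw [map_ofNat, h0, map_zero]))
  rcases Int.units_eq_one_or (Equiv.Perm.sign (permGal W h2 σ)) with h | h <;> rw [h]
  · simp only [Units.val_one, Int.cast_one, one_mul, ne_eq, not_true_eq_false, iff_false]
    decide
  · simp only [Units.val_neg, Units.val_one, Int.cast_neg, Int.cast_one, neg_mul, one_mul, ne_eq, true_iff]
    intro hneg
    apply mul_ne_zero h2' hδ
    linear_combination -hneg

/-- **`σ` acts on `E[2]` as a TRANSPOSITION iff `σ δ ≠ δ`** (`δ = ∏_{i<j}(xᵢ − xⱼ)`, `16δ² = Δ_E`): an element of `Γ_K` fixes a non-zero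
`2`-torsion point and moves another iff it moves `√Δ_E`. [cite: DokchitserDokchitserMathZ2012, Theorem (1), proof] [cite: Serre1972, §5.3] -/
theorem isTransposition_iff_smul_delta_ne (σ : absoluteGaloisGroup K) :
    (∃ m₀ v : W.geomTorsion 2, m₀ ≠ 0 ∧ σ • m₀ = m₀ ∧ σ • v ≠ v) ↔ σ • delta W h2 ≠ delta W h2 :=
  (isTransposition_iff_sign_permGal_eq_neg_one W h2 σ).trans (sign_permGal_eq_neg_one_iff_smul_delta_ne W h2 σ)

/-- **`σ` acts on `E[2]` trivially or without non-zero fixed point (`σ̄ ∈ A₃`) iff `σ δ = δ`.**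
[cite: DokchitserDokchitserMathZ2012, Theorem (1), proof] [cite: Serre1972, §5.3] -/
theorem trivial_or_fpf_iff_smul_delta_eq (σ : absoluteGaloisGroup K) :
    ((∀ m : W.geomTorsion 2, σ • m = m) ∨ (∀ m : W.geomTorsion 2, σ • m = m → m = 0)) ↔ σ • delta W h2 = delta W h2 := by
  rw [← not_iff_not, not_or, not_forall, not_forall]
  refine Iff.trans ?_ (isTransposition_iff_smul_delta_ne W h2 σ)
  constructor
  · rintro ⟨⟨v, hv⟩, m₀, hm₀⟩
    rw [Classical.not_imp] at hm₀
    exact ⟨m₀, v, hm₀.2, hm₀.1, hv⟩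
  · rintro ⟨m₀, v, hm₀, hσm₀, hσv⟩
    exact ⟨⟨v, hσv⟩, m₀, Classical.not_imp.mpr ⟨hσm₀, hm₀⟩⟩

include h2 in
/-- If `Δ_E ∈ K^{×2}` then NO element of `Γ_K` acts on `E[2]` as a transposition (every `σ` fixes `δ`,
`isSquare_Δ_iff_forall_smul_delta`). [cite: DokchitserDokchitserMathZ2012, Theorem (1), proof] -/
theorem not_isTransposition_of_isSquare_Δ [PerfectField K] (hsq : IsSquare W.Δ) (σ : absoluteGaloisGroup K) :
    ¬ ∃ m₀ v : W.geomTorsion 2, m₀ ≠ 0 ∧ σ • m₀ = m₀ ∧ σ • v ≠ v := by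
  rw [isTransposition_iff_smul_delta_ne W h2 σ, not_not]
  exact (isSquare_Δ_iff_forall_smul_delta W h2).mp hsq σ

include h2 in
/-- If `Δ_E ∉ K^{×2}` (`K` perfect) then SOME element of `Γ_K` acts on `E[2]` as a transposition.
[cite: DokchitserDokchitserMathZ2012, Theorem (1), proof] -/
theorem exists_isTransposition_of_not_isSquare_Δ [PerfectField K] (hsq : ¬ IsSquare W.Δ) :
    ∃ σ : absoluteGaloisGroup K, ∃ m₀ v : W.geomTorsion 2, m₀ ≠ 0 ∧ σ • m₀ = m₀ ∧ σ • v ≠ v := by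
  rw [isSquare_Δ_iff_forall_smul_delta W h2, not_forall] at hsq
  obtain ⟨σ, hσ⟩ := hsq
  exact ⟨σ, (isTransposition_iff_smul_delta_ne W h2 σ).mpr hσ⟩

end One

/-! ## §2 A subgroup: transpositions in `H` ⟺ `H` moves `δ` -/

section Sub

variable {K : Type u} [Field K] (W : WeierstrassCurve K) [W.IsElliptic] (h2 : (2 : K) ≠ 0) (H : Subgroup (absoluteGaloisGroup K))

/-- **`H ≤ Γ_K` contains a transposition on `E[2]` iff `H` does not fix `δ`.** [cite: DokchitserDokchitserMathZ2012, Theorem (1), proof]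
[cite: Serre1972, §5.3] -/
theorem exists_transposition_mem_iff_exists_smul_delta_ne :
    (∃ τ ∈ H, ∃ m₀ v : W.geomTorsion 2, m₀ ≠ 0 ∧ τ • m₀ = m₀ ∧ τ • v ≠ v) ↔ ∃ τ ∈ H, τ • delta W h2 ≠ delta W h2 := by
  simp only [isTransposition_iff_smul_delta_ne W h2]

/-- **`H` has NO transposition on `E[2]`** — every element of `H` acts trivially or without non-zero fixed point, the hypothesis `hnoT`
of the `C₃` counting lemma `PerfectDescent.natCard_equivariant_eq_of_no_transposition` — **iff `H` fixes `δ`.**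
[cite: DokchitserDokchitserMathZ2012, Theorem (1), proof] [cite: Serre1972, §5.3] -/
theorem forall_trivial_or_fpf_iff_forall_smul_delta_eq :
    (∀ g ∈ H, (∀ m : W.geomTorsion 2, g • m = m) ∨ (∀ m : W.geomTorsion 2, g • m = m → m = 0)) ↔
      ∀ g ∈ H, g • delta W h2 = delta W h2 := by
  simp only [trivial_or_fpf_iff_smul_delta_eq W h2]

end Sub

/-! ## §3 `H = Gal(K̄/K_∞)`: transpositions in the tower ⟺ `δ ∉ K_∞` -/

section Tower

variable {K : Type u} [Field K] {p : ℕ} [Fact p.Prime] (κ : ZpExtension K p)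

/-- `x ∈ K_∞ = K̄^{ker κ}` iff `ker κ` fixes `x` (unfolding of `ZpExtension.top`). [cite: Washington1997, §13.1] -/
theorem mem_top_iff_forall_smul_eq (x : AlgebraicClosure K) : x ∈ κ.top ↔ ∀ σ ∈ κ.kerSubgroup, σ • x = x := by
  constructor
  · intro hx σ hσ
    exact ZpExtension.kerSubgroup_le_stabilizer κ hx hσ
  · intro h
    rw [ZpExtension.top, IntermediateField.mem_fixedField_iff]
    rintro _ ⟨σ, hσ, rfl⟩
    exact h σ hσ

variable (W : WeierstrassCurve K) [W.IsElliptic] (h2 : (2 : K) ≠ 0)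

/-- **`Gal(K̄/K_∞)` contains a TRANSPOSITION on `E[2]` iff `δ ∉ K_∞`** («`√Δ_E ∉ K_∞`»; any `ℤ_p`-extension `κ` of a field with
`2 ≠ 0`). [cite: DokchitserDokchitserMathZ2012, Theorem (1), proof] [cite: Washington1997, §13.1] -/
theorem exists_transposition_mem_kerSubgroup_iff_delta_not_mem_top :
    (∃ τ ∈ κ.kerSubgroup, ∃ m₀ v : W.geomTorsion 2, m₀ ≠ 0 ∧ τ • m₀ = m₀ ∧ τ • v ≠ v) ↔ delta W h2 ∉ κ.top := by
  rw [exists_transposition_mem_iff_exists_smul_delta_ne W h2, mem_top_iff_forall_smul_eq]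
  push Not
  exact Iff.rfl

/-- **`Gal(K̄/K_∞)` has NO transposition on `E[2]` (hypothesis `hnoT` of the `C₃` counting lemma) iff `δ ∈ K_∞`.**
[cite: DokchitserDokchitserMathZ2012, Theorem (1), proof] [cite: Washington1997, §13.1] -/
theorem forall_trivial_or_fpf_iff_delta_mem_top :
    (∀ g ∈ κ.kerSubgroup, (∀ m : W.geomTorsion 2, g • m = m) ∨ (∀ m : W.geomTorsion 2, g • m = m → m = 0)) ↔
      delta W h2 ∈ κ.top := by
  rw [forall_trivial_or_fpf_iff_forall_smul_delta_eq W h2, mem_top_iff_forall_smul_eq]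

/-- `16 δ² = Δ_E` in `K̄`: `δ` is a square root of `Δ_E / 16`, so `δ ∈ K_∞ ⟺ √Δ_E ∈ K_∞` (restatement of the tree's
`DokchitserDokchitser2012.algebraMap_Δ` for the reader of §3–§4). [cite: SilvermanAEC2009, III.§1] -/
theorem sixteen_mul_delta_sq : 16 * delta W h2 ^ 2 = algebraMap K (AlgebraicClosure K) W.Δ :=
  (algebraMap_Δ W h2).symm

end Tower

/-! ## §4 `K = ℚ`: the `C₃ / S₃` dichotomy on the seed cell is «`√Δ ∈ ℚ_∞` / `√Δ ∉ ℚ_∞`» -/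

section Rat

variable (W : WeierstrassCurve ℚ) [W.IsElliptic] {p : ℕ} [Fact p.Prime] (κ : ZpExtension ℚ p)

/-- **`Δ_E < 0` ⟹ `δ ∉ ℚ_∞`** for the cyclotomic `ℤ_p`-extension (any `p`): complex conjugation lies in `ker κ` and is a transposition on
`E[2]` (`TowerImage.exists_transposition_mem_kerSubgroup_of_Δ_neg`), hence moves `δ`. [cite: SilvermanAEC2009, III.1]
[cite: SerreAbelianLadic1968, Ch. I §1.2] -/
theorem delta_not_mem_top_of_Δ_neg (hΔ : W.Δ < 0) (hκ : κ.IsCyclotomic) : delta W two_ne_zero ∉ κ.top :=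
  (exists_transposition_mem_kerSubgroup_iff_delta_not_mem_top κ W two_ne_zero).mp
    (exists_transposition_mem_kerSubgroup_of_Δ_neg W κ hΔ hκ)

/-- **THE `S₃ / C₃` DICHOTOMY OF THE COUNTING LEMMA ON THE SEED CELL, DECIDED BY `δ`.** For `E/ℚ` without rational point of order
`2` and the cyclotomic `ℤ₂`-extension `κ` (`Q := ker κ = Gal(ℚ̄/ℚ_∞)`): EITHER `δ ∉ ℚ_∞` and `Q` supplies the `S₃` data — a
fixed-point-free `σ`, and `τ`, `m₀ ≠ 0` with `τ m₀ = m₀`, `τ` non-trivial (hypotheses of `PerfectDescent.natCard_equivariant_S3_bounds`),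
OR `δ ∈ ℚ_∞` and `Q` supplies the `C₃` data — a fixed-point-free `σ` and «every element trivial or fixed-point-free» (hypotheses of
`PerfectDescent.natCard_equivariant_eq_of_no_transposition`). The first case contains the whole `Δ < 0` half-cell
(`delta_not_mem_top_of_Δ_neg`). [cite: Serre1972, §5.3] [cite: DokchitserDokchitserMathZ2012, Theorem (1), proof] [cite: Washington1997, §13.1] -/
theorem S3_or_C3_kerSubgroup (κ : ZpExtension ℚ 2) (ht : ∀ x : ℚ, ¬ HasRationalTwoTorsionX W x) :
    (delta W two_ne_zero ∉ κ.top ∧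
      ∃ σ ∈ κ.kerSubgroup, ∃ τ ∈ κ.kerSubgroup, ∃ m₀ : W.geomTorsion 2,
        (∀ m : W.geomTorsion 2, σ • m = m → m = 0) ∧ m₀ ≠ 0 ∧ τ • m₀ = m₀ ∧ ¬ ∀ m : W.geomTorsion 2, τ • m = m) ∨
    (delta W two_ne_zero ∈ κ.top ∧
      (∃ σ ∈ κ.kerSubgroup, ∀ m : W.geomTorsion 2, σ • m = m → m = 0) ∧
        ∀ g ∈ κ.kerSubgroup, (∀ m : W.geomTorsion 2, g • m = m) ∨ (∀ m : W.geomTorsion 2, g • m = m → m = 0)) := by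
  obtain ⟨σ, hσ, hfpf⟩ := exists_fpf_mem_kerSubgroup_of_forall_not_hasRationalTwoTorsionX W κ (by decide) ht
  by_cases hδ : delta W two_ne_zero ∈ κ.top
  · exact Or.inr ⟨hδ, ⟨σ, hσ, hfpf⟩, (forall_trivial_or_fpf_iff_delta_mem_top κ W two_ne_zero).mpr hδ⟩
  · obtain ⟨τ, hτ, m₀, v, hm₀, hτm₀, hτv⟩ :=
      (exists_transposition_mem_kerSubgroup_iff_delta_not_mem_top κ W two_ne_zero).mpr hδ
    exact Or.inl ⟨hδ, σ, hσ, τ, hτ, m₀, hfpf, hm₀, hτm₀, fun h ↦ hτv (h v)⟩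

/-- **`Δ_E ∈ ℚ^{×2}` never happens next to a transposition** — consistency with the cell binder `¬ IsSquare W.Δ` of route
`AlignedTransportAtTwo`: if `Δ_E` were a square, `Gal(ℚ̄/ℚ_∞)` (indeed `Γ_ℚ`) would have no transposition on `E[2]` and the `C₃` case
would be forced. [cite: DokchitserDokchitserMathZ2012, Theorem (1), proof] -/
theorem delta_mem_top_of_isSquare_Δ (hsq : IsSquare W.Δ) : delta W two_ne_zero ∈ κ.top :=
  (mem_top_iff_forall_smul_eq κ _).mpr fun σ _ ↦ (isSquare_Δ_iff_forall_smul_delta W two_ne_zero).mp hsq σ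

end Rat

end Summit.BirchSwinnertonDyer.BirchSwinnertonDyer.Theorems.AlignedTransportAtTwoFineRoad.TowerImageDelta

end
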